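import Summits.Langlands.Langlands.Theses.PrimitiveRankLadder

/-!
# Glue of the layer-2 re-split (gen 4) of `SatakeAvatarExistence` (route PrimitiveRankLadder, lens-1-g12 ⊕ g11 ⊕ g10)

Closes the glue item of `route-Langlands-PrimitiveRankLadder` generated by
`--resplit SatakeAvatarExistence --glue-decl-name SatakeAvatarExistence_of_split5`:
`SatakeAvatarExistence_of_split5 :
  SpreadInducedAvatar → QuadraticTwistDescent → HigherInverseInduction → TowerTransport → WeaklyRegularHullAvatars →
    InaccessiblePrimitiveAvatars → CuspidalAvatarIrreducible → SatakeAvatarExistence`.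
Pure logic; ONE excluded middle «the datum `π.1` lies in the tower-induction hull HULL₃» (the impredicative least class inlined,
negated, in `InaccessiblePrimitiveAvatars`): instantiate leastness at the class «cuspidal L-algebraic data of positive rank having a
SEMISIMPLE Satake–Frobenius avatar for every (ℓ, ι)».  (r0₂) a rung-≤-2 seed is either in the regular-induction hull HULL₁ — then the
g10 leastness of HULL₁ at the same class (rung 1: SPRAI applied to EVERY cuspidal L-algebraic `π'` of the induced-regular type `T`
is the twist family; `by_cases` on the box `n = 2 ∧ [K:K₀] = 2` routes it to Q (`subst n`) or H; (up)/(ai) by TRN₃.1 = RTT 29150 /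
TRN₃.2.1 = AIT 29151) — or off HULL₁, and then, being in HULL₂ by its own seed clause, WHS hands the avatar.  (up)/(ai) of HULL₃ by
TRN₃.1 / TRN₃.2.1 again.  (ext) the dark step: TRN₃.2.2 = DSS turns the avatars of the sub-type members over the (arbitrary) base
`K₀` into the type-`T` twist family over `K₀`, and Q (box, `subst n`) or H — typed for an arbitrary base — descends it to `π`.  IRR
makes the avatar irreducible.  Off HULL₃, REST₄ is W⁺ verbatim.  This is the lens-1-g12 node proof
`TowerInductionLadder.satakeAvatarExistence_of_split5` (decomp-langlands, 2026-08-30; certified against the gate render in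
kit_check.lean and fullrender_probe.lean, rc 0), over the tree's declarations.  No definitions, no new mathematics.
-/

set_option linter.dupNamespace false -- project-wide option; `Summit.Langlands.Langlands` is the mandated namespace

namespace Summit.Langlands.Langlands.Theorems

open scoped Classical
open Filter

/-- The glue item of the gen-4 re-split of `PrimitiveRankLadder.SatakeAvatarExistence` (stmt-Langlands-17415): SPRAI (twist family
over the TR/CM base), Q / H (inverse induction on / off the box (2,2), any base), TRN₃ (the three print transports saturating the
tower hull), WHS (the weakly-regular belt), REST₄ (off the tower hull) and IRR imply W⁺. -/
theorem SatakeAvatarExistence_of_split5_proof :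
    Summit.Langlands.Langlands.Theses.PrimitiveRankLadder.SatakeAvatarExistence_of_split5 := by
  intro hS hQ hH hT hW hR hI K _ _ n hcpt hn π hL ℓ _ ι
  obtain ⟨hRt, hA, hD⟩ := hT
  by_cases hh3 : ∀ S : (∀ (K : Type) [Field K] [NumberField K] (n : ℕ) (hcpt : Literature.NumberTheory.Automorphic.isCompact_glFiniteIntegralLevel n K), Literature.NumberTheory.Automorphic.AutomorphicRepData (Literature.NumberTheory.Automorphic.AutomorphyDatum.gl n K hcpt) → Prop), ((∀ (K : Type) [Field K] [NumberField K] (n : ℕ) (hcpt : Literature.NumberTheory.Automorphic.isCompact_glFiniteIntegralLevel n K) (π : Literature.NumberTheory.Automorphic.CuspidalAutomorphicRepData n K hcpt), 0 < n → π.1.IsLAlgebraic → (∃ (K₀ : Type) (_ : Field K₀) (_ : NumberField K₀) (_ : Algebra K₀ K), IsGalois K₀ K ∧ IsCyclic (K ≃ₐ[K₀] K) ∧ (NumberField.IsTotallyReal K₀ ∨ NumberField.IsCMField K₀) ∧ ∃ T : Literature.NumberTheory.Automorphic.InfinityType K n, π.1.HasInfinityType T ∧ (Literature.NumberTheory.Automorphic.InfinityType.automorphicInduction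 K₀ (n * Module.finrank K₀ K) T).IsWeaklyRegular) → S K n hcpt π.1) ∧ (∀ (K₀ : Type) [Field K₀] [NumberField K₀] (M : Type) [Field M] [NumberField M] [Algebra K₀ M] (n : ℕ) (h₀ : Literature.NumberTheory.Automorphic.isCompact_glFiniteIntegralLevel n K₀) (hM : Literature.NumberTheory.Automorphic.isCompact_glFiniteIntegralLevel n M) (h₁ : Literature.NumberTheory.Automorphic.isCompact_glFiniteIntegralLevel 1 M) (π₀ : Literature.NumberTheory.Automorphic.CuspidalAutomorphicRepData n K₀ h₀) (χ : Literature.NumberTheory.Automorphic.AutomorphicRepData (Literature.NumberTheory.Automorphic.AutomorphyDatum.gl 1 M h₁)) (P : Literature.NumberTheory.Automorphic.AutomorphicRepData (Literature.NumberTheory.Automorphic.AutomorphyDatum.gl n M hM)), π₀.1.IsLAlgebraic → χ.IsLAlgebraic → (∀ᶠ w : IsDedekindDomain.HeightOneSpectrum (NumberField.RingOfIntegers M) in cofinite, ∀ (u : IsDedekindDomain.HeightOneSpectrum (NumberField.RingOfIntegers K₀)) (α : Multiset ℂ) (c : ℂ), w.asIdeal.under (NumberField.RingOfIntegers K₀)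 = u.asIdeal → π₀.1.HasSatakeParamAt u α → χ.HasSatakeParamAt w {c} → P.HasSatakeParamAt w ((α.map (· ^ w.asIdeal.inertiaDeg (NumberField.RingOfIntegers K₀))).map (c * ·))) → S K₀ n h₀ π₀.1 → S M n hM P) ∧ (∀ (K : Type) [Field K] [NumberField K] (L : Type) [Field L] [NumberField L] [Algebra K L] (m n : ℕ) (hL : Literature.NumberTheory.Automorphic.isCompact_glFiniteIntegralLevel m L) (hcpt : Literature.NumberTheory.Automorphic.isCompact_glFiniteIntegralLevel n K) (σ : Literature.NumberTheory.Automorphic.CuspidalAutomorphicRepData m L hL) (π : Literature.NumberTheory.Automorphic.AutomorphicRepData (Literature.NumberTheory.Automorphic.AutomorphyDatum.gl n K hcpt)), 0 < m → σ.1.IsLAlgebraic → (∀ᶠ v : IsDedekindDomain.HeightOneSpectrum (NumberField.RingOfIntegers K) in cofinite, ∀ β : IsDedekindDomain.HeightOneSpectrum (NumberField.RingOfIntegers L) → Multiset ℂ, (∀ w : IsDedekindDomain.HeightOneSpectrum (NumberField.RingOfIntegers L), w.asIdeal.under (NumberField.RingOfIntegers K) = v.asIdeal → σ.1.HasSatakeParamAt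 w (β w)) → ∃ α : Multiset ℂ, π.HasSatakeParamAt v α ∧ Literature.NumberTheory.Automorphic.satakePolynomial α = ∏ᶠ w ∈ {w : IsDedekindDomain.HeightOneSpectrum (NumberField.RingOfIntegers L) | w.asIdeal.under (NumberField.RingOfIntegers K) = v.asIdeal}, (Literature.NumberTheory.Automorphic.satakePolynomial (β w)).comp (Polynomial.X ^ w.asIdeal.inertiaDeg (NumberField.RingOfIntegers K))) → S L m hL σ.1 → S K n hcpt π) ∧ (∀ (K : Type) [Field K] [NumberField K] (n : ℕ) (hcpt : Literature.NumberTheory.Automorphic.isCompact_glFiniteIntegralLevel n K), 0 < n → ∀ (K₀ : Type) [Field K₀] [NumberField K₀] [Algebra K₀ K], IsGalois K₀ K → IsCyclic (K ≃ₐ[K₀] K) → ∀ (T : Literature.NumberTheory.Automorphic.InfinityType K n), (Literature.NumberTheory.Automorphic.InfinityType.automorphicInduction K₀ (n * Module.finrank K₀ K) T).IsRegular → (∀ (m : ℕ) (hm : Literature.NumberTheory.Automorphic.isCompact_glFiniteIntegralLevel m K₀) (σ : Literature.NumberTheory.Automorphic.CuspidalAutomorphicRepData m K₀ hm) (τ :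 Literature.NumberTheory.Automorphic.InfinityType K₀ m), 0 < m → σ.1.IsLAlgebraic → σ.1.HasInfinityType τ → (∀ e : K₀ →+* ℂ, τ e ≤ (Literature.NumberTheory.Automorphic.InfinityType.automorphicInduction K₀ (n * Module.finrank K₀ K) T) e) → S K₀ m hm σ.1) → ∀ (π : Literature.NumberTheory.Automorphic.CuspidalAutomorphicRepData n K hcpt), π.1.IsLAlgebraic → π.1.HasInfinityType T → S K n hcpt π.1)) → S K n hcpt π.1
  · -- π.1 is in the tower hull HULL₃: semisimple avatar by LEASTNESS of HULL₃ at the avatar class, then IRR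
    have key := hh3
      (fun K _ _ n hcpt P => 0 < n → P.W ≤ Literature.NumberTheory.Automorphic.cuspFormsGL n K hcpt → P.IsLAlgebraic → ∀ (ℓ : ℕ) [Fact ℓ.Prime] (ι : PadicAlgCl ℓ ≃+* ℂ), ∃ ρ : Literature.NumberTheory.GaloisRepresentations.FramedGaloisRep K (PadicAlgCl ℓ) n, ρ.toGaloisRep.IsSemisimple ∧ ∀ᶠ v : IsDedekindDomain.HeightOneSpectrum (NumberField.RingOfIntegers K) in Filter.cofinite, SatakeFrobCompatibleAt ι P ρ v)
      ⟨?_, ?_, ?_, ?_⟩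
    · obtain ⟨ρ, hss, hc⟩ := key hn π.2 hL ℓ ι
      exact ⟨ρ, hI K n hcpt hn π hL ℓ ι ρ hss hc, hc⟩
    · -- (r0₂) a rung ≤ 2 seed: in the regular-induction hull HULL₁ (leastness of HULL₁: SPRAI + Q/H at rung 1, RTT, AIT) or on the belt (WHS; the seed is in HULL₂)
      intro K _ _ n hcpt π hn hL hd _ _ _ ℓ _ ι
      by_cases hh1 : ∀ S : (∀ (K : Type) [Field K] [NumberField K] (n : ℕ) (hcpt : Literature.NumberTheory.Automorphic.isCompact_glFiniteIntegralLevel n K), Literature.NumberTheory.Automorphic.AutomorphicRepData (Literature.NumberTheory.Automorphic.AutomorphyDatum.gl n K hcpt) → Prop), ((∀ (K : Type) [Field K] [NumberField K] (n : ℕ) (hcpt : Literature.NumberTheory.Automorphic.isCompact_glFiniteIntegralLevel n K) (π : Literature.NumberTheory.Automorphic.CuspidalAutomorphicRepData n K hcpt), 0 < n → π.1.IsLAlgebraic → (∃ (K₀ : Type) (_ : Field K₀) (_ : NumberField K₀) (_ : Algebra K₀ K), IsGalois K₀ K ∧ IsCyclic (K ≃ₐ[K₀] K) ∧ (NumberField.IsTotallyReal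 K₀ ∨ NumberField.IsCMField K₀) ∧ ∃ T : Literature.NumberTheory.Automorphic.InfinityType K n, π.1.HasInfinityType T ∧ (Literature.NumberTheory.Automorphic.InfinityType.automorphicInduction K₀ (n * Module.finrank K₀ K) T).IsRegular) → S K n hcpt π.1) ∧ (∀ (K₀ : Type) [Field K₀] [NumberField K₀] (M : Type) [Field M] [NumberField M] [Algebra K₀ M] (n : ℕ) (h₀ : Literature.NumberTheory.Automorphic.isCompact_glFiniteIntegralLevel n K₀) (hM : Literature.NumberTheory.Automorphic.isCompact_glFiniteIntegralLevel n M) (h₁ : Literature.NumberTheory.Automorphic.isCompact_glFiniteIntegralLevel 1 M) (π₀ : Literature.NumberTheory.Automorphic.CuspidalAutomorphicRepData n K₀ h₀) (χ : Literature.NumberTheory.Automorphic.AutomorphicRepData (Literature.NumberTheory.Automorphic.AutomorphyDatum.gl 1 M h₁)) (P : Literature.NumberTheory.Automorphic.AutomorphicRepData (Literature.NumberTheory.Automorphic.AutomorphyDatum.gl n M hM)), π₀.1.IsLAlgebraic → χ.IsLAlgebraic → (∀ᶠ w : IsDedekindDomain.HeightOneSpectrum (NumberField.RingOfIntegers M)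 in cofinite, ∀ (u : IsDedekindDomain.HeightOneSpectrum (NumberField.RingOfIntegers K₀)) (α : Multiset ℂ) (c : ℂ), w.asIdeal.under (NumberField.RingOfIntegers K₀) = u.asIdeal → π₀.1.HasSatakeParamAt u α → χ.HasSatakeParamAt w {c} → P.HasSatakeParamAt w ((α.map (· ^ w.asIdeal.inertiaDeg (NumberField.RingOfIntegers K₀))).map (c * ·))) → S K₀ n h₀ π₀.1 → S M n hM P) ∧ (∀ (K : Type) [Field K] [NumberField K] (L : Type) [Field L] [NumberField L] [Algebra K L] (m n : ℕ) (hL : Literature.NumberTheory.Automorphic.isCompact_glFiniteIntegralLevel m L) (hcpt : Literature.NumberTheory.Automorphic.isCompact_glFiniteIntegralLevel n K) (σ : Literature.NumberTheory.Automorphic.CuspidalAutomorphicRepData m L hL) (π : Literature.NumberTheory.Automorphic.AutomorphicRepData (Literature.NumberTheory.Automorphic.AutomorphyDatum.gl n K hcpt)), 0 < m → σ.1.IsLAlgebraic → (∀ᶠ v : IsDedekindDomain.HeightOneSpectrum (NumberField.RingOfIntegers K) in cofinite, ∀ β : IsDedekindDomain.HeightOneSpectrum (NumberField.RingOfIntegers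 L) → Multiset ℂ, (∀ w : IsDedekindDomain.HeightOneSpectrum (NumberField.RingOfIntegers L), w.asIdeal.under (NumberField.RingOfIntegers K) = v.asIdeal → σ.1.HasSatakeParamAt w (β w)) → ∃ α : Multiset ℂ, π.HasSatakeParamAt v α ∧ Literature.NumberTheory.Automorphic.satakePolynomial α = ∏ᶠ w ∈ {w : IsDedekindDomain.HeightOneSpectrum (NumberField.RingOfIntegers L) | w.asIdeal.under (NumberField.RingOfIntegers K) = v.asIdeal}, (Literature.NumberTheory.Automorphic.satakePolynomial (β w)).comp (Polynomial.X ^ w.asIdeal.inertiaDeg (NumberField.RingOfIntegers K))) → S L m hL σ.1 → S K n hcpt π)) → S K n hcpt π.1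
      · have key₁ := hh1
          (fun K _ _ n hcpt P => 0 < n → P.W ≤ Literature.NumberTheory.Automorphic.cuspFormsGL n K hcpt → P.IsLAlgebraic → ∀ (ℓ : ℕ) [Fact ℓ.Prime] (ι : PadicAlgCl ℓ ≃+* ℂ), ∃ ρ : Literature.NumberTheory.GaloisRepresentations.FramedGaloisRep K (PadicAlgCl ℓ) n, ρ.toGaloisRep.IsSemisimple ∧ ∀ᶠ v : IsDedekindDomain.HeightOneSpectrum (NumberField.RingOfIntegers K) in Filter.cofinite, SatakeFrobCompatibleAt ι P ρ v)
          ⟨?_, ?_, ?_⟩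
        · exact key₁ hn π.2 hL ℓ ι
        · -- (r0) rung 1: SPRAI over the whole type-T family IS the twist family; Q (box (2,2), `subst n`) or H (complement) descends it to π
          intro K _ _ n hcpt π hn hL hd₁ _ _ _ ℓ _ ι
          obtain ⟨K₀, _, _, _, hG, hcyc, hK₀, T, hT, hreg⟩ := hd₁
          by_cases hb : n = 2 ∧ Module.finrank K₀ K = 2
          · obtain ⟨rfl, hd2⟩ := hb
            exact hQ K hcpt K₀ hG hcyc hd2 T hreg ℓ ι
              (fun π' hL' hT' hK₀' => hS K 2 hcpt hn π' hL' K₀ hG hcyc hK₀ T hT' hreg ℓ ι hK₀') π hL hT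
          · exact hH K n hcpt hn K₀ hG hcyc hb T hreg ℓ ι
              (fun π' hL' hT' hK₀' => hS K n hcpt hn π' hL' K₀ hG hcyc hK₀ T hT' hreg ℓ ι hK₀') π hL hT
        · -- (up) a.e.-twisted weak base change up: first conjunct of TRN₃ (= RTT 29150)
          intro K₀ _ _ M _ _ _ n h₀ hM h₁ π₀ χ P hL₀ hχ hrel hπ₀ hn hP hLP ℓ _ ι
          obtain ⟨ρ₀, h0ss, h0c⟩ := hπ₀ hn π₀.2 hL₀ ℓ ι
          exact hRt K₀ M n h₀ hM h₁ hn π₀ χ ⟨P, hP⟩ hL₀ hχ hLP hrel ℓ ι ρ₀ h0ss h0c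
        · -- (ai) automorphic induction down: second conjunct of TRN₃ (= AIT 29151)
          intro K _ _ L _ _ _ m n hL hcpt σ π hm hσ hrel hσS hn hπ hLπ ℓ _ ι
          obtain ⟨r, hrss, hrc⟩ := hσS hm σ.2 hσ ℓ ι
          exact hA K L m n hL hcpt hm hn σ ⟨π, hπ⟩ hσ hLπ hrel ℓ ι r hrss hrc
      · -- off HULL₁ at rung ≤ 2: the seed lies in HULL₂, so WHS hands the semisimple avatar
        exact hW K n hcpt hn π hL hh1 (fun S hS => hS.1 K n hcpt π hn hL hd) ℓ ι
    · -- (up) a.e.-twisted weak base change up: first conjunct of TRN₃ (= RTT 29150)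
      intro K₀ _ _ M _ _ _ n h₀ hM h₁ π₀ χ P hL₀ hχ hrel hπ₀ hn hP hLP ℓ _ ι
      obtain ⟨ρ₀, h0ss, h0c⟩ := hπ₀ hn π₀.2 hL₀ ℓ ι
      exact hRt K₀ M n h₀ hM h₁ hn π₀ χ ⟨P, hP⟩ hL₀ hχ hLP hrel ℓ ι ρ₀ h0ss h0c
    · -- (ai) automorphic induction down: second conjunct of TRN₃ (= AIT 29151)
      intro K _ _ L _ _ _ m n hL hcpt σ π hm hσ hrel hσS hn hπ hLπ ℓ _ ι
      obtain ⟨r, hrss, hrc⟩ := hσS hm σ.2 hσ ℓ ι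
      exact hA K L m n hL hcpt hm hn σ ⟨π, hπ⟩ hσ hLπ hrel ℓ ι r hrss hrc
    · -- (ext) the DARK STEP: DSS spreads the sub-type members' avatars into the type-T twist family over K₀ (print);
      -- Q (box (2,2), `subst n`) or H (complement) — typed for an ARBITRARY base K₀ — descends it to π
      intro K _ _ n hcpt hn K₀ _ _ _ hG hcyc T hreg hsub π hL hT _ _ _ ℓ _ ι
      have hfam := hD K n hcpt hn K₀ hG hcyc T ℓ ι
        (fun m hm σ τ hm0 hσ hτ hle => hsub m hm σ τ hm0 hσ hτ hle hm0 σ.2 hσ ℓ ι)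
      by_cases hb : n = 2 ∧ Module.finrank K₀ K = 2
      · obtain ⟨rfl, hd2⟩ := hb
        exact hQ K hcpt K₀ hG hcyc hd2 T hreg ℓ ι hfam π hL hT
      · exact hH K n hcpt hn K₀ hG hcyc hb T hreg ℓ ι hfam π hL hT
  · -- off the tower hull: REST₄ is W⁺ verbatim there
    exact hR K n hcpt hn π hL hh3 ℓ ι

end Summit.Langlands.Langlands.Theorems
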